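/-
Width seat `ym-line-cbag-p1-w3` (prover-ym-line-cbag-p1-w3-g8-0), the only seat on LINE 3 `route-QuantumFields-SixPlaneColdBox`, crux
`TorusMeanNearColdBoxG` (stmt-QuantumFields-25708), infrared stub: the two cold-box inputs — the free half at EVERY torus side, passed to the
torus-limit states, and the value `D/4β` of the cold-box centre mean.
-/
import Summits.QuantumFields.YangMills.Theorems.SixPlaneColdBoxTorusMeanLowerG
import Summits.QuantumFields.YangMills.Theorems.SixPlaneColdBoxFlatBoxMeanG
import Summits.QuantumFields.YangMills.Theorems.WeakCouplingRatesBulkDominatesColdBoxWDirKernelDiagFlat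
import Summits.QuantumFields.YangMills.Theorems.WeakCouplingRatesCurvatureKernel

/-!
# Route `SixPlaneColdBox`, crux `TorusMeanNearColdBoxG`: cold-box inputs of the infrared stub

* `torusMean_sub_boxMean_ge_side` — the free half `−3β^{−5/4} ≤ E_{torus L+1}[plaqCost0 q ∘ torusLift] − E_{box ⌈β^θ⌉}[c_q(centre)]` for EVERY
  torus side `L + 1 ≥ L₀(β)` (verbatim `torusMean_sub_boxMean_ge`, which is the odd-side case);
* `limitMean_ge_boxMean` — hence for every torus-limit state `μ ∈ infiniteVolumeLimitPoints r.ρ β` (β large) and every plane `q`: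
  `E_{box ⌈β^θ⌉}[c_q(centre)] − 3β^{−5/4} ≤ E_μ[N − Re tr r(U_{(0;q)})]` (bounded continuous cylinder observable along the defining tori);
* `boxMean_centre_ge` — the cold-box centre mean is at least the free value: `β·E_{box ⌈β^θ⌉}[c_q(centre)] ≥ (D/2)(1/2 − K/⌈β^θ⌉⁴) − β^{−1/4}`
  (`flatBoxMean_centre_sharp`; the Dirichlet projection kernel at the centre is the `ℤ⁴` curl kernel up to `K/H⁴`,
  `exists_boxDirProjKernel_sub_curl_bound`, whose diagonal is `curvatureTwoPoint p p = 2/d = 1/2`, `curvatureTwoPoint_self`).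

No sorry; standard axioms.  NOT the Yang–Mills mass gap.
-/

set_option autoImplicit false

noncomputable section

open MeasureTheory ProbabilityTheory Finset Real Filter Topology Metric
open scoped ENNReal
open Literature.Probability.LatticeModels (Site glueWith)
open Literature.MathematicalPhysics.QuantumLattice
open Literature.MathematicalPhysics.QuantumFieldTheory
open Literature.MathematicalPhysics.QuantumFieldTheory.LatticeMaxwell
open Literature.MathematicalPhysics.QuantumFieldTheory.AxialGauge
open Literature.MathematicalPhysics.QuantumFieldTheory.LatticeForm (d₁)
open Summit.QuantumFields.YangMills.Theorems.WeakCouplingRates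
open Summit.QuantumFields.YangMills.Theorems.FreeEnergyLogCoefficient
open Summit.QuantumFields.YangMills.Theorems.ColdBoxAllGroups

namespace Summit.QuantumFields.YangMills.Theorems.SixPlaneColdBox

set_option maxHeartbeats 800000 in
/-- **The free half at every torus side.**  For every compact simple `G`, lattice representation `r` and `0 < θ ≤ 1/200`: for all large `β`, then
all torus sides `L + 1 ≥ L₀` and every plane `q`, `−3β^{−5/4} ≤ E_{torus L+1}[plaqCost0 q ∘ torusLift] − E_{box ⌈β^θ⌉}[c_{(centre;q)}]`. -/
theorem torusMean_sub_boxMean_ge_side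
    (G : Type) [Group G] [TopologicalSpace G] [IsTopologicalGroup G] [CompactSpace G] [MeasurableSpace G] [BorelSpace G]
    (hG : IsCompactSimpleLieGroup G) (r : LatticeRep G) {θ : ℝ} (hθ : 0 < θ) (hθ2 : θ ≤ 1 / 200) :
    ∃ β₀ : ℝ, ∀ β : ℝ, β₀ ≤ β → ∃ L₀ : ℕ, ∀ L : ℕ, L₀ ≤ L → ∀ q : {q : Fin 4 × Fin 4 // q.1 < q.2},
      -(3 * β ^ (-(5 / 4 : ℝ))) ≤
        (∫ U, plaqCost0 r.ρ q.1.1 q.1.2 (torusLift (L + 1) U) ∂(wilsonMeasure (d := 4) (L := L + 1) r.ρ β)) -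
          (∫ W, plaqCostAt r.ρ (boxCentre ⌈β ^ θ⌉₊) q.1.1 q.1.2 W ∂(boxState r.ρ β ⌈β ^ θ⌉₊)) := by
  haveI : SecondCountableTopology G := r.secondCountableTopology
  have hρc : Continuous r.ρ := r.continuous
  have hρu : ∀ g, r.ρ g ∈ Matrix.unitaryGroup (Fin r.N) ℂ := r.mem_unitary
  have hA : (0 : ℝ) < θ / 2 := by positivity
  have hAθ : θ / 2 < θ := by linarith
  have hδ : (0 : ℝ) < θ / 5 := by positivity
  obtain ⟨K, -, βa, hlowβ⟩ := sixPlane_goodDatum_hlow G hG r hA hAθ hθ2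
  obtain ⟨βc, hrare⟩ := stub_largeFieldRarityG G r (θ / 5) hδ
  set Nr : ℝ := (r.N : ℝ) with hNr
  have hNr0 : 0 ≤ Nr := Nat.cast_nonneg _
  obtain ⟨βe, hβe⟩ := Filter.eventually_atTop.1
    (eventually_const_rpow_exp_le_rpow_div (C := 4 * Nr * (6 * 2401)) (s := 4 * θ) (b := -(5 / 4 : ℝ)) hδ one_pos)
  refine ⟨max (max βa βc) (max βe 1), fun β hβ => ?_⟩
  simp only [max_le_iff] at hβ
  obtain ⟨⟨hba, hbc⟩, hbe, hβ1⟩ := hβ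
  have hβ0 : 0 < β := by linarith
  have hH2 : (⌈β ^ θ⌉₊ : ℝ) ≤ 2 * β ^ θ := (one_le_ceil_rpow_and_le hβ1 hθ.le).2
  obtain ⟨L₀, hL₀⟩ := Filter.eventually_atTop.1 (hrare β hbc)
  refine ⟨max L₀ (2 * (2 * ⌈β ^ θ⌉₊ + 0 + 2)), fun L hLge q => ?_⟩
  simp only [max_le_iff] at hLge
  obtain ⟨hSL, hSbig⟩ := hLge
  have hL : 2 * (2 * ⌈β ^ θ⌉₊ + 0 + 2) < L + 1 := by omega
  have hL2 := hL₀ L hSL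
  haveI := isProbabilityMeasure_wilsonMeasure (d := 4) (L := L + 1) (G := G) r.ρ hρc β
  haveI : IsProbabilityMeasure (boxState r.ρ β ⌈β ^ θ⌉₊) := isProbabilityMeasure_boxKernelG r.ρ hρc β ⌈β ^ θ⌉₊ (fun _ => 1)
  haveI hKprob : ∀ U : GaugeConfig 4 (L + 1) G, IsProbabilityMeasure (boxKernelG r.ρ β ⌈β ^ θ⌉₊ (torusLift (L + 1) U)) :=
    fun U => isProbabilityMeasure_boxKernelG r.ρ hρc β ⌈β ^ θ⌉₊ _
  set μ := wilsonMeasure (d := 4) (L := L + 1) r.ρ β with hμ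
  have hml := measurable_torusLift (d := 4) (G := G) (L + 1)
  set h : GaugeConfig 4 (L + 1) G → ℝ := fun U =>
    ∫ W, plaqCostAt r.ρ (boxCentre ⌈β ^ θ⌉₊) q.1.1 q.1.2 W ∂(boxKernelG r.ρ β ⌈β ^ θ⌉₊ (torusLift (L + 1) U)) with hh
  set E1 : ℝ := ∫ W, plaqCostAt r.ρ (boxCentre ⌈β ^ θ⌉₊) q.1.1 q.1.2 W ∂(boxState r.ρ β ⌈β ^ θ⌉₊) with hE1
  have hmean : ∫ U, plaqCost0 r.ρ q.1.1 q.1.2 (torusLift (L + 1) U) ∂μ = ∫ U, h U ∂μ :=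
    (torusMean_eq_kernelMean_pairG (H := ⌈β ^ θ⌉₊) (T := 0) (L := L) r.ρ hρc hρu β hL q q).1
  have hcK : ∀ W, |plaqCostAt r.ρ (boxCentre ⌈β ^ θ⌉₊) q.1.1 q.1.2 W| ≤ 2 * Nr := fun W =>
    abs_plaqCostAt_leG r.ρ hρu _ q.1.1 q.1.2 W
  have hhK : ∀ U, |h U| ≤ 2 * Nr := fun U => abs_integral_ymSpecification_le r.ρ hρc β _ hcK _
  have hE1K : |E1| ≤ 2 * Nr := abs_integral_le_of_abs_le _ hcK
  have hhi : Integrable h μ := by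
    refine Integrable.of_bound
      ((continuous_integral_ymSpecification r.ρ hρc β (AxialGauge.boxEdges 4 (2 * ⌈β ^ θ⌉₊ + 1))
        (continuous_plaqCostAtG r.ρ hρc _ q.1.1 q.1.2) hcK).measurable.comp hml).aestronglyMeasurable (2 * Nr)
        (ae_of_all _ fun U => ?_)
    rw [Real.norm_eq_abs]; exact hhK U
  -- the bad event and its mass
  set E : Set (GaugeConfig 4 (L + 1) G) := {U | torusLift (L + 1) U ∈
      ⋃ z ∈ (Fintype.piFinset fun _ : Fin 4 => Finset.Icc (-1 : ℤ) (2 * (⌈β ^ θ⌉₊ : ℤ) + 1)) ×ˢ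
          ((Finset.univ : Finset (Fin 4 × Fin 4)).filter fun q => q.1 < q.2),
        {W : LGConfig 4 G | β ^ (2 * (θ / 5) - 1) < plaqCostAt r.ρ z.1 z.2.1 z.2.2 W}} with hE
  have hEm : MeasurableSet E := hml (measurableSet_badSetG r.ρ hρc β (θ / 5) ⌈β ^ θ⌉₊)
  have hgood : ∀ U, U ∉ E → CrudeGoodG r.ρ β (θ / 5) ⌈β ^ θ⌉₊ (torusLift (L + 1) U) :=
    fun U hU => crudeGoodG_of_not_mem_badSet r.ρ hU
  set p : ℝ := ((6 * (2 * ⌈β ^ θ⌉₊ + 3) ^ 4 : ℕ) : ℝ) * Real.exp (-(β ^ (θ / 5))) with hp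
  have hμE : μ.real E ≤ p := measureReal_badSetG_le r.ρ hρc hL2
  have hp_le : p ≤ 6 * 2401 * (β ^ (4 * θ) * Real.exp (-(β ^ (θ / 5)))) := badMass_le_rpow hβ1 hθ.le hH2
  have hbad : 4 * Nr * μ.real E ≤ β ^ (-(5 / 4 : ℝ)) := by
    have e1 := hβe β hbe
    rw [div_one] at e1
    calc 4 * Nr * μ.real E ≤ 4 * Nr * p := mul_le_mul_of_nonneg_left hμE (by positivity)
      _ ≤ 4 * Nr * (6 * 2401 * (β ^ (4 * θ) * Real.exp (-(β ^ (θ / 5))))) := mul_le_mul_of_nonneg_left hp_le (by positivity)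
      _ = 4 * Nr * (6 * 2401) * (β ^ (4 * θ) * Real.exp (-(β ^ (θ / 5)))) := by ring
      _ ≤ β ^ (-(5 / 4 : ℝ)) := e1
  have h54 : 0 ≤ β ^ (-(5 / 4 : ℝ)) := by positivity
  have hpt : ∀ U, -(2 * β ^ (-(5 / 4 : ℝ))) - 4 * Nr * E.indicator (fun _ => (1 : ℝ)) U ≤ h U - E1 := by
    intro U
    by_cases hU : U ∈ E
    · rw [Set.indicator_of_mem hU, mul_one]
      have h1 := hhK U
      have h2 := hE1K
      rw [abs_le] at h1 h2
      linarith
    · rw [Set.indicator_of_notMem hU, mul_zero, sub_zero]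
      have hn : 0 ≤ β * h U - β * E1 + 2 * β ^ (-(1 / 4 : ℝ)) := (hlowβ β hba (torusLift (L + 1) U) (hgood U hU)).1 q
      have e : β * β ^ (-(5 / 4 : ℝ)) = β ^ (-(1 / 4 : ℝ)) := by
        rw [← Real.rpow_one_add' hβ0.le (by norm_num)]; norm_num
      have h3 : β * (-(2 * β ^ (-(5 / 4 : ℝ)))) ≤ β * (h U - E1) := by
        have : β * (-(2 * β ^ (-(5 / 4 : ℝ)))) = -(2 * (β * β ^ (-(5 / 4 : ℝ)))) := by ring
        rw [this, e]
        linarith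
      exact le_of_mul_le_mul_left h3 hβ0
  have hindi : Integrable (fun U => E.indicator (fun _ => (1 : ℝ)) U) μ := (integrable_const 1).indicator hEm
  have i1 : Integrable (fun U => -(2 * β ^ (-(5 / 4 : ℝ))) - 4 * Nr * E.indicator (fun _ => (1 : ℝ)) U) μ :=
    (integrable_const _).sub (hindi.const_mul _)
  have i2 : Integrable (fun U => h U - E1) μ := hhi.sub (integrable_const _)
  have hint : ∫ U, (-(2 * β ^ (-(5 / 4 : ℝ))) - 4 * Nr * E.indicator (fun _ => (1 : ℝ)) U) ∂μ ≤ ∫ U, (h U - E1) ∂μ :=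
    integral_mono i1 i2 hpt
  have lhs : ∫ U, (-(2 * β ^ (-(5 / 4 : ℝ))) - 4 * Nr * E.indicator (fun _ => (1 : ℝ)) U) ∂μ =
      -(2 * β ^ (-(5 / 4 : ℝ))) - 4 * Nr * μ.real E := by
    rw [integral_sub (integrable_const _) (hindi.const_mul _), integral_const, integral_const_mul,
      integral_indicator_const (1 : ℝ) hEm, smul_eq_mul, smul_eq_mul, probReal_univ, one_mul, mul_one]
  have rhs : ∫ U, (h U - E1) ∂μ = (∫ U, h U ∂μ) - E1 := by
    rw [integral_sub hhi (integrable_const _), integral_const, smul_eq_mul, probReal_univ, one_mul]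
  have hint' : -(2 * β ^ (-(5 / 4 : ℝ))) - 4 * Nr * μ.real E ≤ (∫ U, h U ∂μ) - E1 := by
    rw [← lhs, ← rhs]; exact hint
  rw [hmean]
  linarith [hint', hbad]

/-- **The free half for torus-limit states.**  For every compact simple `G`, `r`, `0 < θ ≤ 1/200`: for all large `β`, every
`μ ∈ infiniteVolumeLimitPoints r.ρ β` and every plane `q`, `E_{box ⌈β^θ⌉}[c_{(centre;q)}] − 3β^{−5/4} ≤ E_μ[N − Re tr r(U_{(0;q)})]`. -/
theorem limitMean_ge_boxMean
    (G : Type) [Group G] [TopologicalSpace G] [IsTopologicalGroup G] [CompactSpace G] [MeasurableSpace G] [BorelSpace G]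
    (hG : IsCompactSimpleLieGroup G) (r : LatticeRep G) {θ : ℝ} (hθ : 0 < θ) (hθ2 : θ ≤ 1 / 200) :
    ∃ β₀ : ℝ, ∀ β : ℝ, β₀ ≤ β → ∀ μ ∈ infiniteVolumeLimitPoints (d := 4) r.ρ β, ∀ q : {q : Fin 4 × Fin 4 // q.1 < q.2},
      (∫ W, plaqCostAt r.ρ (boxCentre ⌈β ^ θ⌉₊) q.1.1 q.1.2 W ∂(boxState r.ρ β ⌈β ^ θ⌉₊)) - 3 * β ^ (-(5 / 4 : ℝ)) ≤
        ∫ U, ((r.N : ℝ) - plaquetteObs r.ρ 0 q.1.1 q.1.2 U) ∂μ := by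
  haveI : SecondCountableTopology G := r.secondCountableTopology
  have hρc : Continuous r.ρ := r.continuous
  obtain ⟨β₀, hβ₀⟩ := torusMean_sub_boxMean_ge_side G hG r hθ hθ2
  refine ⟨β₀, fun β hβ μ hμ q => ?_⟩
  obtain ⟨L₀, hL₀⟩ := hβ₀ β hβ
  obtain ⟨Ls, hLs, hlim⟩ := hμ
  haveI : IsProbabilityMeasure μ := hlim.1
  have hPabs : ∀ U : LGConfig 4 G, |plaquetteObs r.ρ 0 q.1.1 q.1.2 U| ≤ r.N := fun U => by
    have h := Literature.RepresentationTheory.CompactGroups.CompactGroup.abs_re_trace_le_card r.ρ r.continuous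
      (plaquetteHolonomyZd U 0 q.1.1 q.1.2)
    simpa only [Fintype.card_fin, Literature.MathematicalPhysics.QuantumLattice.plaquetteObs] using h
  have hconv := hlim.2 (plaquetteObs r.ρ 0 q.1.1 q.1.2) _ (isCylinder_plaquetteObs r.ρ (((0 : Site 4), q) : ZdPlaquette 4))
    (continuous_plaquetteObs r.ρ hρc 0 q.1.1 q.1.2) ⟨r.N, hPabs⟩
  -- along the defining tori the free half holds eventually
  set E1 : ℝ := ∫ W, plaqCostAt r.ρ (boxCentre ⌈β ^ θ⌉₊) q.1.1 q.1.2 W ∂(boxState r.ρ β ⌈β ^ θ⌉₊) with hE1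
  have hev : ∀ᶠ k : ℕ in atTop, wilsonExpectation (L := Ls k + 1) r.ρ β (toTorusObservable (Ls k + 1) (plaquetteObs r.ρ 0 q.1.1 q.1.2)) ≤
      (r.N : ℝ) - E1 + 3 * β ^ (-(5 / 4 : ℝ)) := by
    filter_upwards [eventually_ge_atTop L₀] with k hk
    have hLk : L₀ ≤ Ls k := hk.trans (StrictMono.le_apply hLs)
    have h := hL₀ (Ls k) hLk q
    haveI := isProbabilityMeasure_wilsonMeasure (d := 4) (L := Ls k + 1) (G := G) r.ρ hρc β
    have hPi : Integrable (fun U : GaugeConfig 4 (Ls k + 1) G => plaquetteObs r.ρ 0 q.1.1 q.1.2 (torusLift (Ls k + 1) U))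
        (wilsonMeasure (d := 4) (L := Ls k + 1) r.ρ β) :=
      Integrable.of_bound (((continuous_plaquetteObs r.ρ hρc 0 q.1.1 q.1.2).measurable.comp
        (measurable_torusLift (d := 4) (G := G) (Ls k + 1))).aestronglyMeasurable) (r.N : ℝ)
        (ae_of_all _ fun U => by rw [Real.norm_eq_abs]; exact hPabs _)
    have e : ∫ U, plaqCost0 r.ρ q.1.1 q.1.2 (torusLift (Ls k + 1) U) ∂(wilsonMeasure (d := 4) (L := Ls k + 1) r.ρ β) =
        (r.N : ℝ) - ∫ U, plaquetteObs r.ρ 0 q.1.1 q.1.2 (torusLift (Ls k + 1) U) ∂(wilsonMeasure (d := 4) (L := Ls k + 1) r.ρ β) := by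
      simp only [plaqCost0]
      rw [integral_sub (integrable_const _) hPi, integral_const, smul_eq_mul, probReal_univ, one_mul]
    rw [e] at h
    show ∫ U, plaquetteObs r.ρ 0 q.1.1 q.1.2 (torusLift (Ls k + 1) U) ∂(wilsonMeasure (d := 4) (L := Ls k + 1) r.ρ β) ≤
      (r.N : ℝ) - E1 + 3 * β ^ (-(5 / 4 : ℝ))
    linarith
  have hle : ∫ U, plaquetteObs r.ρ 0 q.1.1 q.1.2 U ∂μ ≤ (r.N : ℝ) - E1 + 3 * β ^ (-(5 / 4 : ℝ)) :=
    le_of_tendsto hconv hev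
  have hPiμ : Integrable (plaquetteObs r.ρ 0 q.1.1 q.1.2) μ :=
    Integrable.of_bound (continuous_plaquetteObs r.ρ hρc 0 q.1.1 q.1.2).measurable.aestronglyMeasurable (r.N : ℝ)
      (ae_of_all _ fun U => by rw [Real.norm_eq_abs]; exact hPabs U)
  rw [integral_sub (integrable_const _) hPiμ, integral_const, smul_eq_mul, probReal_univ, one_mul]
  linarith

/-- **The cold-box centre mean is at least the free value `D/4β`, up to `K/⌈β^θ⌉⁴` and `β^{−5/4}`.**  For every compact simple `G`, `r` and
`0 < θ ≤ 1/200` there are `K ≥ 0` and `β₀` with, for `β ≥ β₀` and every plane `i < j`,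
`(D/2)(1/2) − (D/2)·K/⌈β^θ⌉⁴ − β^{−1/4} ≤ β·E_{box ⌈β^θ⌉}[c_{(centre;i,j)}]`, `D = dimE r.ρ`. -/
theorem boxMean_centre_ge
    (G : Type) [Group G] [TopologicalSpace G] [IsTopologicalGroup G] [CompactSpace G] [MeasurableSpace G] [BorelSpace G]
    (hG : IsCompactSimpleLieGroup G) (r : LatticeRep G) {θ : ℝ} (hθ : 0 < θ) (hθ2 : θ ≤ 1 / 200) :
    ∃ K : ℝ, 0 ≤ K ∧ ∃ β₀ : ℝ, ∀ β : ℝ, β₀ ≤ β → ∀ (i j : Fin 4), i < j →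
      (dimE r.ρ : ℝ) / 2 * (1 / 2) - (dimE r.ρ : ℝ) / 2 * (K / (⌈β ^ θ⌉₊ : ℝ) ^ 4) - β ^ (-(1 / 4 : ℝ)) ≤
        β * (∫ U, plaqCostAt r.ρ (boxCentre ⌈β ^ θ⌉₊) i j U ∂(boxState r.ρ β ⌈β ^ θ⌉₊)) := by
  haveI : SecondCountableTopology G := r.secondCountableTopology
  haveI : NeZero r.N := ⟨latticeRep_N_ne_zero G hG r⟩
  obtain ⟨β₁, hflat⟩ := flatBoxMean_centre_sharp r.ρ r.continuous r.injective r.mem_unitary hθ hθ2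
  obtain ⟨K, hK0, hK⟩ := exists_boxDirProjKernel_sub_curl_bound
  -- `⌈β^θ⌉ ≥ 32` eventually
  obtain ⟨β₂, hβ₂⟩ := Filter.eventually_atTop.1 ((tendsto_rpow_atTop hθ).eventually_ge_atTop (32 : ℝ))
  refine ⟨K, hK0, max β₁ β₂, fun β hβ i j hij => ?_⟩
  have hb₁ : β₁ ≤ β := (le_max_left _ _).trans hβ
  have hb₂ : β₂ ≤ β := (le_max_right _ _).trans hβ
  have hH32 : (32 : ℝ) ≤ (⌈β ^ θ⌉₊ : ℝ) := (hβ₂ β hb₂).trans (Nat.le_ceil _)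
  have h1 := hflat β hb₁ i j hij
  rw [abs_le] at h1
  -- the Dirichlet projection kernel at the centre against the `ℤ⁴` curl kernel
  have hc0 : ‖(boxCentre ⌈β ^ θ⌉₊ : Site 4) - boxCentre ⌈β ^ θ⌉₊‖ ≤ (⌈β ^ θ⌉₊ : ℝ) / 8 := by
    rw [sub_self, norm_zero]; positivity
  have h2 := hK ⌈β ^ θ⌉₊ hH32 (boxCentre ⌈β ^ θ⌉₊, i, j) (boxCentre ⌈β ^ θ⌉₊, i, j) hij hij hc0 hc0
  dsimp only at h2
  have h3 : d₁ (LatticeChain.div₂ (greenTensor ((boxCentre ⌈β ^ θ⌉₊, i, j) : Plaq 4))) (boxCentre ⌈β ^ θ⌉₊) i j = 1 / 2 := by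
    have e := curvatureTwoPoint_eq_curl_greenTensor (((boxCentre ⌈β ^ θ⌉₊ : Site 4), ⟨(i, j), hij⟩) : ZdPlaquette 4)
      (((boxCentre ⌈β ^ θ⌉₊ : Site 4), ⟨(i, j), hij⟩) : ZdPlaquette 4)
    rw [curvatureTwoPoint_self (by norm_num) _] at e
    norm_num at e
    exact e.symm
  rw [h3, abs_le] at h2
  have hD0 : 0 ≤ (dimE r.ρ : ℝ) / 2 := by positivity
  have h4 : (dimE r.ρ : ℝ) / 2 * (1 / 2 - K / (⌈β ^ θ⌉₊ : ℝ) ^ 4) ≤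
      (dimE r.ρ : ℝ) / 2 * boxDirProjKernel ⌈β ^ θ⌉₊ (boxCentre ⌈β ^ θ⌉₊, i, j) (boxCentre ⌈β ^ θ⌉₊, i, j) :=
    mul_le_mul_of_nonneg_left (by linarith [h2.1]) hD0
  have e4 : (dimE r.ρ : ℝ) / 2 * (1 / 2 - K / (⌈β ^ θ⌉₊ : ℝ) ^ 4) =
      (dimE r.ρ : ℝ) / 2 * (1 / 2) - (dimE r.ρ : ℝ) / 2 * (K / (⌈β ^ θ⌉₊ : ℝ) ^ 4) := by ring
  linarith [h1.1]

end Summit.QuantumFields.YangMills.Theorems.SixPlaneColdBox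

end
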